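import Literature.Barriers.CriticalPhenomena.RigorousRGSmallParameterHHWThm22CertSound
import Literature.Barriers.CriticalPhenomena.RigorousRGSmallParameterHHWNewmanBounds
import Literature.Barriers.CriticalPhenomena.RigorousRGSmallParameterHHWMomentMono
import HarnessLib

/-!
# Hara–Hattori–Watanabe 2001, Theorem 2.2 from Newman's bound (A.6) and the certificate

Hara–Hattori–Watanabe (CMP 220 (2001) 13–40) prove Theorem 2.2 — the hypotheses (2.14)–(2.17) of
Theorem 2.1 for `N₀ = 70`, `N₁ = 100`, and `1.7925671170092624 ≤ s̲₁₀₀`, `s̄₁₀₀ ≤ 1.7925671170092625`;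
vendored as the named fact `HaraHattoriWatanabe2001_thm22` (`…HHWReduction.lean`) — in §5 by a
computer-aided evaluation (§5.3) of the truncated moment recursion of Proposition 5.1 plus three
analytic inputs. All three inputs are now theorems of the tree except Newman's bound:

* the recursion (5.4), (5.6), (5.7) — `HierarchicalRG.taylorA_traj_succ` (`…HHWTaylorRecursion`);
* the monotonicity of `a_{n,N}(s)` in `s` (§5.3 (3), (5.34)) — `HierarchicalRG.taylorA_traj_mono`
  (`…HHWMomentMono`, Griffiths' inequalities);
* Newman's inequality (A.6) `a_{M+N} ≤ a_M a_N` (Proposition A.1) — the named fact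
  `HaraHattoriWatanabe2001_eqA6` (`…HHWNewmanBounds`), the only remaining hypothesis.

The computation is the kernel/compiler-checked certificate `Thm22Cert.cert_ok : cfg.check = true`
(`…HHWThm22Cert`, `native_decide`: the enclosure run of Proposition 5.1 at `M = 60`, `P = 330`
bits, `N ≤ 100`, at `s₋`, `s₊`, and the final inequalities of §5.3), whose meaning for real
coefficient families is `Thm22Cert.Cfg.check_sound` (`…HHWThm22CertSound`, Proposition 5.1
re-proved). This file identifies the abstract families with `a_{n,N}(s±) = taylorA (traj s± N) n`
((5.2) from `moment_isingLaw`, (5.7) from `taylorA_traj_succ`, `a_0 = 1`, `a_n ≥ 0`) and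
assembles **`HaraHattoriWatanabe2001_thm22_of_eqA6 : HaraHattoriWatanabe2001_eqA6 →
HaraHattoriWatanabe2001_thm22`** — the window bounds through the infimum characterisations
(2.11)–(2.12) and `taylorA_traj_mono`, the bounds (2.14)–(2.16) on `[s̲₁₀₀, s̄₁₀₀] ⊆ [s₋, s₊]` by the
endpoint mixing (5.34). Axioms: the whitelist plus the `native_decide` auxiliary of `cert_ok`.
-/

noncomputable section

namespace Literature.Barriers.CriticalPhenomena

open _root_.MeasureTheory _root_.ProbabilityTheory _root_.Filter _root_.Set
open scoped _root_.Topology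

namespace HierarchicalRG

open Thm22Cert

/-- The initial values (5.2): `a_{n,0} = n! s^{2n}/(2n)!`. [cite: HaraHattoriWatanabe2001, §5.1 eq. (5.2)] -/
theorem taylorA_traj_init (s : ℝ) (n : ℕ) :
    taylorA (traj s 0) n = (n.factorial : ℝ) / (2 * n).factorial * s ^ (2 * n) := by
  rw [traj_zero, taylorA, moment_isingLaw, (even_two_mul n).neg_pow]
  ring

/-- **(5.7) with (5.4), (5.6) in closed form**: `a_{n,N+1} = ã_n/ã_0` with
`ã_n = Σ_m (β/2)^m b_{m+n} tildeCoef m n` written as a `tsum` (from `taylorA_traj_succ`).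
[cite: HaraHattoriWatanabe2001, §5.1 eqs. (5.4), (5.6), (5.7)] -/
theorem taylorA_traj_succ_tsum (s : ℝ) (N n : ℕ) :
    taylorA (traj s (N + 1)) n =
      (∑' m : ℕ, (beta (Real.sqrt 2) / 2) ^ m * bOf (fun l => taylorA (traj s N) l) (m + n) * tildeCoef m n) /
        (∑' m : ℕ, (beta (Real.sqrt 2) / 2) ^ m * bOf (fun l => taylorA (traj s N) l) (m + 0) * tildeCoef m 0) := by
  obtain ⟨T, hT, hrec, -⟩ := taylorA_traj_succ s N
  rw [hrec n, (hT n).tsum_eq, (hT 0).tsum_eq]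

/-- `s₋` as a real number. [cite: HaraHattoriWatanabe2001, Theorem 2.2] -/
theorem sMinus_eq : ((sMinusNum : ℕ) : ℝ) / 10 ^ 16 = 1.7925671170092624 := by
  norm_num [sMinusNum]

/-- `s₊` as a real number. [cite: HaraHattoriWatanabe2001, Theorem 2.2] -/
theorem sPlus_eq : ((sPlusNum : ℕ) : ℝ) / 10 ^ 16 = 1.7925671170092625 := by
  norm_num [sPlusNum]

end HierarchicalRG

open HierarchicalRG HierarchicalRG.Thm22Cert in
/-- **HHW Theorem 2.2 from Newman's bound (A.6) and the certificate.** Given (A.6) along the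
trajectory, the kernel/compiler-checked run of Proposition 5.1 (`cert_ok`, `check_sound`), the
proved recursion (5.7) (`taylorA_traj_succ`) and the proved monotonicity in `s`
(`taylorA_traj_mono`) yield Theorem 2.2: the hypotheses of Theorem 2.1 for `N₀ = 70`, `N₁ = 100`,
and `1.7925671170092624 ≤ s̲₁₀₀`, `s̄₁₀₀ ≤ 1.7925671170092625`.
[cite: HaraHattoriWatanabe2001, Theorem 2.2, Proposition 5.1 and §5.3] -/
theorem HaraHattoriWatanabe2001_thm22_of_eqA6 (hA6 : HaraHattoriWatanabe2001_eqA6) :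
    HaraHattoriWatanabe2001_thm22 := by
  set sM : ℝ := ((sMinusNum : ℕ) : ℝ) / 10 ^ 16 with hsM
  set sP : ℝ := ((sPlusNum : ℕ) : ℝ) / 10 ^ 16 with hsP
  have hsM0 : 0 ≤ sM := by positivity
  have hsP0' : 0 ≤ sP := by positivity
  have hsP0 : 0 < sP := by rw [hsP]; norm_num [sPlusNum]
  obtain ⟨h217, h1, h2, h3, hN0⟩ := Cfg.check_sound cert_ok
    (aM := fun N n => taylorA (traj sM N) n) (aP := fun N n => taylorA (traj sP N) n)
    (fun N => taylorA_zero _) (fun N n => taylorA_nonneg _ _) (fun N m n => hA6 sM hsM0 N m n)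
    (fun N n => taylorA_traj_succ_tsum sM N n) (fun n => taylorA_traj_init sM n)
    (fun N => taylorA_zero _) (fun N n => taylorA_nonneg _ _) (fun N m n => hA6 sP hsP0' N m n)
    (fun N n => taylorA_traj_succ_tsum sP N n) (fun n => taylorA_traj_init sP n)
  simp only [show cfg.nSteps = 100 from rfl, show cfg.N0 = 70 from rfl] at h217 h1 h2 h3 hN0
  -- monotonicity transport
  have mono : ∀ {s t : ℝ}, 0 ≤ s → s ≤ t → ∀ N n, taylorA (traj s N) n ≤ taylorA (traj t N) n :=
    fun hs hst N n => taylorA_traj_mono N n hs (hs.trans hst) hst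
  -- the window bounds
  have hlow : sM ≤ sLow 100 := by
    refine le_csInf ⟨sP, hsP0, ?_⟩ fun s hs => ?_
    · show 1 ≤ mu2 (traj sP 100)
      exact h2.le
    · obtain ⟨hs0, hs1⟩ := hs
      change 1 ≤ taylorA (traj s 100) 1 at hs1
      by_contra hlt
      push Not at hlt
      have := mono hs0.le hlt.le 100 1
      linarith
  have hup : sUp 100 ≤ sP := by
    refine csInf_le ⟨0, fun s hs => hs.1.le⟩ ⟨hsP0, ?_⟩
    exact (min_le_left _ _).trans h3.le
  refine ⟨?_, by rw [← sMinus_eq]; exact hlow, by rw [← sPlus_eq]; exact hup⟩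
  intro s hs
  have hs1 : sM ≤ s := hlow.trans hs.1
  have hs2 : s ≤ sP := hs.2.trans hup
  have hs0 : 0 ≤ s := hsM0.trans hs1
  have hB := hN0 (fun n => taylorA (traj s 70) n) fun n _ _ => ⟨mono hsM0 hs1 70 n, mono hs0 hs2 70 n⟩
  exact ⟨hB.1, hB.2.1, hB.2.2, fun N hN1 hN2 => lt_of_le_of_lt (mono hs0 hs2 N 1) (h217 N hN1 hN2)⟩

end Literature.Barriers.CriticalPhenomena

end
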